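import Mathlib
import Literature.AlgebraicGeometry.Resolution.WeightedResolutionDatum
import HarnessLib
import HarnessLib.Audit

/-!
# The intrinsic e.f.t. local weighted game `LocalWeightedDropEFT p` (H2a′) — door `HypersurfaceCentreConstruction`
# (stmt-ResolutionOfSingularities-19897), route `WeightedInvariant`

[OURS · L1 W4.3 · cell `res-hironaka`] Helper DEFINITION file `--supports stmt-ResolutionOfSingularities-19897`: the
statement-level key of door line `local-engine` v2 (res-L1-w43-plan-1 g7, CRUX-PLAN §v6.7, CHAIN w43 v4.4–v4.5), landed so
that the registered stub `stub_localWeightedDropEFT : ∀ p, p.Prime → LocalWeightedDropEFT p` is keyed to a TREE constant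
and can be closed BY NAME.  A conjecture node (`@[conjecture]`, OURS): STATED, NEVER ASSERTED; nothing here claims anything
about Hironaka's problem.

`LocalWeightedDropEFT p`: positions `(S, f)` — `S` a regular local ring ESSENTIALLY OF FINITE TYPE over a perfect field
`k₀` of characteristic `p` (the local rings of a smooth `k₀`-variety at ALL of its points; residue fields arbitrary,
imperfect in general), `0 ≠ f ∈ 𝔪_S²`; a move is an honest regular system of parameters `u ⊂ S` with weights `w ≠ 0`,
ADMISSIBLE (`f ∈ 𝔪_{S_P}²` for every prime `P ⊇ (u_i : w_i > 0)`, i.e. the centre lies in `Sing V(f)`); successors are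
the local rings `B_𝔫` of the full cobordant blow-up `B = S[t⁻¹, Iₙ tⁿ]` (`extReesAlgebra (weightedMonomialIdeal u w)`,
Literature `WeightedResolutionDatum`) at every prime `𝔫 ∋ t⁻¹` over `𝔪_S` off the vertex, with the `t⁻¹`-saturated
transform `g` of `f`; won = `g ∉ 𝔪_{B_𝔫}²`, else an ordinal class function `ι` (chosen once, invariant under ring
isomorphisms) drops.  Why it might fail (recorded for refuters): over imperfect residue fields the p-th-root cleanings
of the algebraically-closed engine are unavailable; in print only for `dim S ≤ 3`.
-/

set_option linter.dupNamespace false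

noncomputable section

open IsLocalRing Literature.AlgebraicGeometry.Resolution

namespace Summit.ResolutionOfSingularities.ResolutionOfSingularities.Cruxes.HypersurfaceCentreConstruction.LocalEngine

section SuccessorEFT

variable {S : Type} [CommRing S] {n : ℕ}

/-- The full cobordant blow-up algebra `B = S[t⁻¹, Iₙ tⁿ]` of the regular weighted centre
`(u_i^{1/w_i})` (`extReesAlgebra` of the weighted monomial filtration). -/
abbrev cobordantAlgebra' (u : Fin n → S) (w : Fin n → ℕ) : Type :=
  extReesAlgebra (weightedMonomialIdeal u w)

/-- `t⁻¹ ∈ B` (equation of the exceptional divisor on `B₊`). -/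
abbrev cobordantT' (u : Fin n → S) (w : Fin n → ℕ) : cobordantAlgebra' u w :=
  extReesAlgebra.tInv (weightedMonomialIdeal u w)

end SuccessorEFT

/-- H2a′ candidate (e.f.t. form): the INTRINSIC weighted game on hypersurfaces in regular local rings
essentially of finite type over a perfect field `k₀` of characteristic `p` is won positionally.  `ι` is a
class function on (ring, element) chosen once; a position is `(S, f)` with `0 ≠ f ∈ 𝔪_S²` (singular
hypersurface germ); a move is a regular system of parameters `u` (spanning `𝔪_S`, of length `embdim S`)
with weights `w ≠ 0`, ADMISSIBLE (the centre `V(u_i : w_i > 0)` inside `Sing V(f)`: `f ∈ 𝔪_{S_P}²` for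
every prime `P ⊇ (u_i : w_i > 0)`); for every prime `𝔫` of the cobordant algebra `B` lying over `𝔪_S`,
containing `t⁻¹` and not containing the vertex ideal, and every `t⁻¹`-saturated equation `g` of the
transform of `f`, either the successor germ is not singular (`g ∉ 𝔪_{B_𝔫}²`) or `ι` drops. -/
@[conjecture]
def LocalWeightedDropEFT (p : ℕ) : Prop :=
  ∃ ι : (R : Type) → [CommRing R] → R → Ordinal.{0},
  -- (c6, idea-2 critic pass 04:36Z) `ι` is invariant under ring isomorphisms — free for every intended
  -- rank, and what lets the assembly put `rank(y) := ι 𝒪_{Y,y} f_y` without threading explicit isos.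
  (∀ (R T : Type) [CommRing R] [CommRing T] (e : R ≃+* T) (g : R), ι T (e g) = ι R g) ∧
  ∀ (k₀ : Type) [Field k₀] [CharP k₀ p] [PerfectField k₀]
    (S : Type) [CommRing S] [Algebra k₀ S] [Algebra.EssFiniteType k₀ S] [IsRegularLocalRing S]
    (f : S), f ≠ 0 → f ∈ (maximalIdeal S) ^ 2 →
    ∃ (n : ℕ) (u : Fin n → S) (w : Fin n → ℕ),
      Ideal.span (Set.range u) = maximalIdeal S ∧ (maximalIdeal S).spanFinrank = n ∧ (∃ i, 0 < w i) ∧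
      (∀ (P : Ideal S) [P.IsPrime], (∀ i, 0 < w i → u i ∈ P) →
        algebraMap S (Localization.AtPrime P) f ∈ (maximalIdeal (Localization.AtPrime P)) ^ 2) ∧
      ∀ (𝔫 : Ideal (cobordantAlgebra' u w)) [𝔫.IsPrime],
        cobordantT' u w ∈ 𝔫 →
        (maximalIdeal S).map (algebraMap S (cobordantAlgebra' u w)) ≤ 𝔫 →
        ¬ (extReesAlgebra.vertexIdeal (weightedMonomialIdeal u w) ≤ 𝔫) →
        ∀ (a : ℕ) (g : cobordantAlgebra' u w),
          algebraMap S (cobordantAlgebra' u w) f = cobordantT' u w ^ a * g →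
          ¬ (cobordantT' u w ∣ g) →
          algebraMap (cobordantAlgebra' u w) (Localization.AtPrime 𝔫) g ∈
            (maximalIdeal (Localization.AtPrime 𝔫)) ^ 2 →
          ι (Localization.AtPrime 𝔫) (algebraMap (cobordantAlgebra' u w) (Localization.AtPrime 𝔫) g) < ι S f

/-- Sanity: the statement is a well-formed `Prop` family. -/
example : ℕ → Prop := LocalWeightedDropEFT

end Summit.ResolutionOfSingularities.ResolutionOfSingularities.Cruxes.HypersurfaceCentreConstruction.LocalEngine


/-! ## H2a″ candidate clauses (CRUX-PLAN §v6.8 (A3)) — NOT registered; for strat-1 / idea seats to criticise.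
`LocalWeightedDropEFTStrong p` = H2a′ + (c7) generization-monotonicity + (c8) upper semicontinuity on schemes locally of
finite type over a field; `eft_of_eftStrong` is the one-line glue back to the registered H2a′. (c9) max-stratum move is
described in CRUX-PLAN §v6.8 and not yet typed. -/

namespace Summit.ResolutionOfSingularities.ResolutionOfSingularities.Cruxes.HypersurfaceCentreConstruction.LocalEngine

open AlgebraicGeometry CategoryTheory

end Summit.ResolutionOfSingularities.ResolutionOfSingularities.Cruxes.HypersurfaceCentreConstruction.LocalEngine

end
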